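import Mathlib
import Summits.Ventures.PercRepro2.MixChordORootEdgeClosureAll

/-!
# The `o`-class `D`-chord by induction on the root edges of `a₃`, modulo the middle Bernstein
coefficient (β₁) (blind cell PercRepro2, night-1 g22; proofs/NIGHT1-G22.md §7–§8)

`Beta1RootEdge p … f` is the middle Bernstein coefficient of the root-edge closure at `p` along
`f = {o, a₁}`: for every edge `e = {a₁, a₃}` (resp. `{a₂, a₃}`), `0 ≤ Q₀Q₁Q₁⁰²·Δ₀ + S` (resp. its
root-swapped form).  **`dChord_of_beta1_of_base`**: if `Beta1RootEdge` holds at every weight vector of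
the instance and the `D`-chord holds whenever every root edge of `a₃` has weight `0`, then the `D`-chord
holds at every weight vector — strong induction on the number of root edges of `a₃` of positive weight,
one step = `dChord_of_update_zero_of_beta1` / `'`.  The `o`-class row therefore reduces, modulo (β₁),
to the instances in which `a₃` carries no root edge of positive weight (measure-theoretically: no root
edge at all).  Own code; standard axioms.
-/

namespace Summit.Ventures.PercRepro2

open UnionCluster CovForm

namespace Mix

section Induction

variable {V : Type*} {E : Type*} [Fintype E] [DecidableEq E] [Fintype V] [DecidableEq V]
  {R : Type*} [Field R] [LinearOrder R] [IsStrictOrderedRing R]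

variable (p : E → R) (ends : E → Sym2 V) (o a₁ a₂ a₃ b : V) (f : E)

/-- **The middle Bernstein coefficient (β₁) at `p`**, for every root edge of `a₃`: at `e = {a₁, a₃}` the
coefficient of MixChordORootEdgeClosure.lean, at `e = {a₂, a₃}` its root-swapped form. -/
def Beta1RootEdge : Prop :=
  (∀ e, ends e = s(a₁, a₃) →
    0 ≤ prob (Function.update p e 0) (avoidAll ends a₂ {a₁}) *
        prob (Function.update p e 1) (avoidAll ends a₂ {a₁}) *
        prob (Function.update (Function.update p f 0) e 1) (avoidAll ends a₂ {a₁}) ^ 2 *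
        (Gc (Function.update p e 0) ends o a₁ a₂ a₃ b *
            prob (Function.update (Function.update p f 0) e 0) (PDEvent ends a₁ a₂ a₃) -
          (1 - p f) * Gc (Function.update (Function.update p f 0) e 0) ends o a₁ a₂ a₃ b *
            prob (Function.update p e 0) (PDEvent ends a₁ a₂ a₃)) +
      SClosure p ends o a₁ a₂ a₃ b e f) ∧
  (∀ e, ends e = s(a₂, a₃) →
    0 ≤ prob (Function.update p e 0) (avoidAll ends a₁ {a₂}) *
        prob (Function.update p e 1) (avoidAll ends a₁ {a₂}) *
        prob (Function.update (Function.update p f 0) e 1) (avoidAll ends a₁ {a₂}) ^ 2 *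
        (Gc (Function.update p e 0) ends o a₂ a₁ a₃ b *
            prob (Function.update (Function.update p f 0) e 0) (PDEvent ends a₂ a₁ a₃) -
          (1 - p f) * Gc (Function.update (Function.update p f 0) e 0) ends o a₂ a₁ a₃ b *
            prob (Function.update p e 0) (PDEvent ends a₂ a₁ a₃)) +
      SClosure p ends o a₂ a₁ a₃ b e f)

/-- The root edges of `a₃` of positive weight. -/
noncomputable def posRootEdges : Finset E :=
  Finset.univ.filter (fun e => (ends e = s(a₁, a₃) ∨ ends e = s(a₂, a₃)) ∧ p e ≠ 0)

variable {p ends o a₁ a₂ a₃ b f}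

omit [Fintype V] [IsStrictOrderedRing R] in
/-- Pinning a positive root edge to `0` removes it from `posRootEdges` and nothing else changes. -/
lemma posRootEdges_update_zero {e : E} (he : e ∈ posRootEdges p ends a₁ a₂ a₃) :
    posRootEdges (Function.update p e 0) ends a₁ a₂ a₃ = (posRootEdges p ends a₁ a₂ a₃).erase e := by
  ext x
  simp only [posRootEdges, Finset.mem_filter, Finset.mem_univ, true_and, Finset.mem_erase]
  by_cases hx : x = e
  · subst hx
    simp
  · rw [Function.update_of_ne hx]
    tauto

omit [Fintype E] [DecidableEq E] [Fintype V] [DecidableEq V] in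
/-- A root edge of `a₃` is not the `o`-edge. -/
lemma rootEdge_ne_o_edge (hf : ends f = s(o, a₁)) (ho3 : o ≠ a₃) (h13 : a₁ ≠ a₃) {e : E}
    (he : ends e = s(a₁, a₃) ∨ ends e = s(a₂, a₃)) : e ≠ f := by
  intro h
  have h3 : a₃ ∈ ends f := by
    rw [← h]
    rcases he with he | he <;> rw [he] <;> exact Sym2.mem_mk_right _ _
  rw [hf] at h3
  rcases Sym2.mem_iff.1 h3 with h' | h'
  · exact ho3 h'.symm
  · exact h13 h'.symm

/-- **The `o`-class `D`-chord from (β₁) and the base case** (strong induction on the number of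
positive-weight root edges of `a₃`): if (β₁) holds at every admissible weight vector of the instance
and the chord holds whenever `a₃` has no root edge of positive weight, the chord holds at every
admissible weight vector. -/
theorem dChord_of_beta1_of_base (hf : ends f = s(o, a₁)) (ho3 : o ≠ a₃) (h13 : a₁ ≠ a₃)
    (hβ : ∀ p : E → R, IsProbVec p → Beta1RootEdge p ends o a₁ a₂ a₃ b f)
    (hbase : ∀ p : E → R, IsProbVec p → posRootEdges p ends a₁ a₂ a₃ = ∅ →
      NMixChord (normD ends a₁ a₂ a₃) p ends o a₁ a₂ a₃ b f) :
    ∀ p : E → R, IsProbVec p → NMixChord (normD ends a₁ a₂ a₃) p ends o a₁ a₂ a₃ b f := by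
  suffices key : ∀ n : ℕ, ∀ p : E → R, IsProbVec p → (posRootEdges p ends a₁ a₂ a₃).card = n →
      NMixChord (normD ends a₁ a₂ a₃) p ends o a₁ a₂ a₃ b f from
    fun p hp => key _ p hp rfl
  intro n
  induction n using Nat.strong_induction_on with
  | _ n ih =>
    intro p hp hn
    rcases Finset.eq_empty_or_nonempty (posRootEdges p ends a₁ a₂ a₃) with hempty | ⟨e, he⟩
    · exact hbase p hp hempty
    · have he' := he
      simp only [posRootEdges, Finset.mem_filter, Finset.mem_univ, true_and] at he'
      have hef : e ≠ f := rootEdge_ne_o_edge hf ho3 h13 he'.1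
      have hp0 : IsProbVec (Function.update p e 0) := hp.update e le_rfl zero_le_one
      have hcard : (posRootEdges (Function.update p e 0) ends a₁ a₂ a₃).card < n := by
        rw [posRootEdges_update_zero he, Finset.card_erase_of_mem he, ← hn]
        exact Nat.sub_lt (Finset.card_pos.2 ⟨e, he⟩) Nat.one_pos
      have h0 := ih _ hcard (Function.update p e 0) hp0 rfl
      rcases he'.1 with hends | hends
      · exact dChord_of_update_zero_of_beta1 p ends b hp hends hf hef ((hβ p hp).1 e hends) h0
      · exact dChord_of_update_zero_of_beta1' p ends b hp hends hf hef ((hβ p hp).2 e hends) h0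

end Induction

end Mix

end Summit.Ventures.PercRepro2
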